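import Summits.SmoothPoincare4.SmoothPoincare4.Theorems.EntropyRungCompactShrinkerGapScalarIdentities
import Literature.Geometry.Riemannian.GradientShrinkerProofs
import Literature.Geometry.Lorentzian.RicciNormSq
import Literature.Geometry.Lorentzian.MetricNormSq
import HarnessLib

/-!
# `∫ |∇R|² dV = 2 ∫ R (|Ric|² − R²/4) dV` on a closed four-dimensional gradient shrinker
(registered helper `helper_gradScalarCurvature_energy` of line `cgy-variance-pivot`, crux
`EntropyRung.CompactShrinkerGap`, item stmt-SmoothPoincare4-10870)

For a Riemannian metric `g` (Levi-Civita connection) on a closed `4`-manifold and a smooth `f`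
with `Ric + Hess f = g/2` (a gradient shrinking Ricci soliton; no normalisation of `f` is used),
the unweighted scalar-gradient energy identity

  `∫_M |∇R|² dV_g = 2 ∫_M R (|Ric|² − R²/4) dV_g`

holds, where `R = g.scalarCurvature`, `|∇R|² = g⁻¹(dR, dR) = g.gradSq R` and
`|Ric|² = R_{ij}R^{ij} = g.normSq (Ric)`; the right side is `2 ∫ R |E̊|² dV`, `E̊ = Ric − (R/4) g`
the traceless Ricci tensor.

Proof (integration by parts on the closed manifold; every integrand is continuous, the volume is
finite):
1. Green's first identity with `u = v = R` (`integral_mul_dalembertian_riemVolume`):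
   `∫ R ΔR = −∫ g⁻¹(dR, dR) = −∫ |∇R|²`.
2. The scalar identity (B) `ΔR = g⁻¹(dR, df) + R − 2|Ric|²` of a gradient shrinker (landed
   `Theorems.stub_shrinkerScalarIdentities`, p71473) gives
   `∫ R ΔR = ∫ R g⁻¹(dR, df) + ∫ R² − 2 ∫ R |Ric|²`.
3. Green's first identity with `u = R²`, `v = f` and the product rule `d(R²) = 2R dR`
   (Mathlib's `mvfderiv_mul`): `∫ R² Δf = −∫ g⁻¹(d(R²), df) = −2 ∫ R g⁻¹(dR, df)`, while the
   traced soliton equation `Δf = 2 − R` (`IsGradientShrinker.scalarCurvature_add_dalembertian_one`,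
   `finrank ℝ ℝ⁴ = 4`) gives `∫ R² Δf = 2∫R² − ∫R³`; hence `∫ R g⁻¹(dR, df) = −∫R² + ½∫R³`.
4. Summing: `∫ |∇R|² = 2∫ R|Ric|² − ½∫R³ = 2 ∫ R (|Ric|² − R²/4)`.

Sanity check: the round `S⁴(√6)` (`R ≡ 2`, `|Ric|² ≡ 1 = R²/4`): both sides vanish; more
generally both sides vanish on every Einstein shrinker.
Everything is proved; no definition, no named fact.

References: H.-D. Cao, M. Zhu, arXiv:1008.0842, (3.6)–(3.7) [CaoZhu2010]; X. Cheng,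
E. Ribeiro Jr, D. Zhou, arXiv:2203.14916, Lemma 1 [ChengRibeiroZhou2022]; M. Eminenti,
G. La Nave, C. Mantegazza, Manuscripta Math. 127 (2008), Prop. 2.2 [EminentiNaveMantegazza2006];
J. M. Lee, *Introduction to Riemannian Manifolds* (2018), Problem 2-23 [Lee2018].
-/

noncomputable section

-- the registered namespace `Summit.SmoothPoincare4.SmoothPoincare4.Theorems` repeats a component
set_option linter.dupNamespace false

open Bundle Set Function Filter Module MeasureTheory
open scoped Manifold ContDiff ENNReal Topology ContinuousMap

namespace Summit.SmoothPoincare4.SmoothPoincare4.Theorems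

open Literature.Geometry Literature.Geometry.Lorentzian Literature.Geometry.Riemannian
  Literature.Geometry.Lorentzian.PseudoRiemannianMetric

/-- **Scalar-gradient energy identity, from (B)**: on a closed 4-manifold with Riemannian `g`
(Levi-Civita) and smooth `f` with `Ric + Hess f = g/2`, GIVEN (B)
`ΔR = g⁻¹(dR, df) + R − 2|Ric|²` for this `(g, f)`, one has
`∫ |∇R|² dV = 2 ∫ R (|Ric|² − R²/4) dV`: Green's first identity
(`integral_mul_dalembertian_riemVolume`) twice — with `u = v = R` (`∫ R ΔR = −∫|∇R|²`) and with
`u = R²`, `v = f` (`∫ R² Δf = −2∫ R g⁻¹(dR, df)`, product rule `mvfderiv_mul`) — together with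
the trace `Δf = 2 − R` of the soliton equation
(`IsGradientShrinker.scalarCurvature_add_dalembertian_one`); every integrand is continuous on
the compact `M` (`continuous_innerDual_mvfderiv`, `contMDiff_normSq_ricci'`), `riemVolume_eq`.
[cite: CaoZhu2010, (3.6)–(3.7)] [cite: ChengRibeiroZhou2022, Lemma 1]
[cite: Lee2018, Problem 2-23 (a)] -/
theorem gradScalarCurvatureEnergy_of_identityB
    (M : Type) [TopologicalSpace M] [T2Space M] [SecondCountableTopology M]
    [ChartedSpace (EuclideanSpace ℝ (Fin 4)) M] [IsManifold (𝓡 4) ∞ M] [CompactSpace M]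
    [T3Space M] [MeasurableSpace M] [BorelSpace M]
    (g : Literature.Geometry.Lorentzian.PseudoRiemannianMetric (𝓡 4) ∞ (EuclideanSpace ℝ (Fin 4))
      (TangentSpace (𝓡 4) : M → Type _)) [g.HasLeviCivita] (f : M → ℝ) (hg : g.IsRiemannian)
    (hf : ContMDiff (𝓡 4) 𝓘(ℝ, ℝ) ∞ f)
    (hsol : ∀ (x : M) (X Y : TangentSpace (𝓡 4) x),
      g.ricci x X Y + g.hessian f x X Y = (1 / 2 : ℝ) * g.val x X Y)
    (hB : ∀ x : M, g.dalembertian g.scalarCurvature x =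
      g.innerDual x (mvfderiv (𝓡 4) g.scalarCurvature x : TangentSpace (𝓡 4) x →ₗ[ℝ] ℝ)
          (mvfderiv (𝓡 4) f x : TangentSpace (𝓡 4) x →ₗ[ℝ] ℝ) +
        g.scalarCurvature x - 2 * g.normSq x (g.ricci x)) :
    ∫ x, g.gradSq (fun y => g.scalarCurvature y) x
        ∂(Literature.Geometry.Lorentzian.riemannianMeasure (g.toContMDiffRiemannianMetric hg)) =
      2 * ∫ x, g.scalarCurvature x * (g.normSq x (g.ricci x) - (g.scalarCurvature x) ^ 2 / 4)
        ∂(Literature.Geometry.Lorentzian.riemannianMeasure (g.toContMDiffRiemannianMetric hg)) := by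
  -- the Riemannian measure is `g.riemVolume`, a finite measure
  have hV : g.riemVolume = riemannianMeasure (g.toContMDiffRiemannianMetric hg) :=
    PseudoRiemannianMetric.riemVolume_eq hg
  haveI : IsFiniteMeasure g.riemVolume := ⟨g.riemVolume_univ_lt_top⟩
  have hE : finrank ℝ (EuclideanSpace ℝ (Fin 4)) = 4 := finrank_euclideanSpace_fin
  rw [← hV]
  -- regularity of `R`, `R²` and `f`
  have hR : ContMDiff (𝓡 4) 𝓘(ℝ, ℝ) ∞ g.scalarCurvature := g.contMDiff_scalarCurvature
  have hR1 : ContMDiff (𝓡 4) 𝓘(ℝ, ℝ) 1 g.scalarCurvature := hR.of_le (by norm_num)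
  have hR2 : ContMDiff (𝓡 4) 𝓘(ℝ, ℝ) 2 g.scalarCurvature :=
    hR.of_le (WithTop.coe_le_coe.mpr le_top)
  have hRR1 : ContMDiff (𝓡 4) 𝓘(ℝ, ℝ) 1 (g.scalarCurvature * g.scalarCurvature) := hR1.mul hR1
  have hf1 : ContMDiff (𝓡 4) 𝓘(ℝ, ℝ) 1 f := hf.of_le (by norm_num)
  have hf2 : ContMDiff (𝓡 4) 𝓘(ℝ, ℝ) 2 f := hf.of_le (WithTop.coe_le_coe.mpr le_top)
  -- continuity, hence integrability, of every integrand
  have hRc : Continuous g.scalarCurvature := hR.continuous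
  have hPc : Continuous fun x ↦ g.innerDual x
      (mvfderiv (𝓡 4) g.scalarCurvature x : TangentSpace (𝓡 4) x →ₗ[ℝ] ℝ)
      (mvfderiv (𝓡 4) f x : TangentSpace (𝓡 4) x →ₗ[ℝ] ℝ) :=
    continuous_innerDual_mvfderiv g hR1 hf1
  have hQc : Continuous fun x ↦ g.normSq x (g.ricci x) := g.contMDiff_normSq_ricci'.continuous
  have iRP : Integrable (fun x ↦ g.scalarCurvature x * g.innerDual x
      (mvfderiv (𝓡 4) g.scalarCurvature x : TangentSpace (𝓡 4) x →ₗ[ℝ] ℝ)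
      (mvfderiv (𝓡 4) f x : TangentSpace (𝓡 4) x →ₗ[ℝ] ℝ)) g.riemVolume :=
    g.integrable_of_continuous (hRc.mul hPc)
  have iR2 : Integrable (fun x ↦ g.scalarCurvature x ^ 2) g.riemVolume :=
    g.integrable_of_continuous (hRc.pow 2)
  have iR3 : Integrable (fun x ↦ g.scalarCurvature x ^ 3) g.riemVolume :=
    g.integrable_of_continuous (hRc.pow 3)
  have iRQ : Integrable (fun x ↦ g.scalarCurvature x * g.normSq x (g.ricci x)) g.riemVolume :=
    g.integrable_of_continuous (hRc.mul hQc)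
  have i2R2 : Integrable (fun x ↦ 2 * g.scalarCurvature x ^ 2) g.riemVolume := iR2.const_mul 2
  have i2RQ : Integrable (fun x ↦ 2 * (g.scalarCurvature x * g.normSq x (g.ricci x)))
      g.riemVolume := iRQ.const_mul 2
  have i4R3 : Integrable (fun x ↦ 1 / 4 * g.scalarCurvature x ^ 3) g.riemVolume :=
    iR3.const_mul (1 / 4)
  have iRPR2 : Integrable (fun x ↦ g.scalarCurvature x * g.innerDual x
      (mvfderiv (𝓡 4) g.scalarCurvature x : TangentSpace (𝓡 4) x →ₗ[ℝ] ℝ)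
      (mvfderiv (𝓡 4) f x : TangentSpace (𝓡 4) x →ₗ[ℝ] ℝ) + g.scalarCurvature x ^ 2)
      g.riemVolume := iRP.add iR2
  -- the traced soliton equation `R + Δf = 2`
  have hshr : g.IsGradientShrinker f 1 := (g.isGradientShrinker_one_iff f).2 hsol
  have hΔf : ∀ x, g.dalembertian f x = 2 - g.scalarCurvature x := fun x ↦ by
    have h := hshr.scalarCurvature_add_dalembertian_one x
    rw [hE] at h
    norm_num at h
    linarith
  -- the product rule `g⁻¹(d(R²), df) = 2 R g⁻¹(dR, df)`
  have hprod : ∀ x, g.innerDual x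
      (mvfderiv (𝓡 4) (g.scalarCurvature * g.scalarCurvature) x : TangentSpace (𝓡 4) x →ₗ[ℝ] ℝ)
      (mvfderiv (𝓡 4) f x : TangentSpace (𝓡 4) x →ₗ[ℝ] ℝ) =
      2 * (g.scalarCurvature x * g.innerDual x
        (mvfderiv (𝓡 4) g.scalarCurvature x : TangentSpace (𝓡 4) x →ₗ[ℝ] ℝ)
        (mvfderiv (𝓡 4) f x : TangentSpace (𝓡 4) x →ₗ[ℝ] ℝ)) := fun x ↦ by
    have hRd : MDifferentiableAt (𝓡 4) 𝓘(ℝ, ℝ) g.scalarCurvature x :=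
      (hR1 x).mdifferentiableAt one_ne_zero
    rw [mvfderiv_mul hRd hRd]
    simp only [PseudoRiemannianMetric.innerDual, ContinuousLinearMap.toLinearMap_add,
      ContinuousLinearMap.toLinearMap_smul, LinearMap.add_apply, LinearMap.smul_apply, smul_eq_mul]
    ring
  -- (1) Green with `u = v = R`, then (B): `−∫|∇R|² = ∫ R ΔR = ∫ R g⁻¹(dR,df) + ∫R² − 2∫R|Ric|²`
  have e1 : -∫ x, g.gradSq (fun y => g.scalarCurvature y) x ∂g.riemVolume =
      ∫ x, g.scalarCurvature x * g.innerDual x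
          (mvfderiv (𝓡 4) g.scalarCurvature x : TangentSpace (𝓡 4) x →ₗ[ℝ] ℝ)
          (mvfderiv (𝓡 4) f x : TangentSpace (𝓡 4) x →ₗ[ℝ] ℝ) ∂g.riemVolume +
        ∫ x, g.scalarCurvature x ^ 2 ∂g.riemVolume -
        2 * ∫ x, g.scalarCurvature x * g.normSq x (g.ricci x) ∂g.riemVolume := by
    have h0 : ∫ x, g.scalarCurvature x * g.dalembertian g.scalarCurvature x ∂g.riemVolume =
        -∫ x, g.gradSq (fun y => g.scalarCurvature y) x ∂g.riemVolume :=
      integral_mul_dalembertian_riemVolume g hg hR1 hR2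
    have hpt : ∀ x, g.scalarCurvature x * g.dalembertian g.scalarCurvature x =
        g.scalarCurvature x * g.innerDual x
            (mvfderiv (𝓡 4) g.scalarCurvature x : TangentSpace (𝓡 4) x →ₗ[ℝ] ℝ)
            (mvfderiv (𝓡 4) f x : TangentSpace (𝓡 4) x →ₗ[ℝ] ℝ) +
          g.scalarCurvature x ^ 2 - 2 * (g.scalarCurvature x * g.normSq x (g.ricci x)) :=
      fun x ↦ by
        rw [hB x]
        ring
    rw [← h0, integral_congr_ae (ae_of_all _ hpt), integral_sub iRPR2 i2RQ,
      integral_add iRP iR2, integral_const_mul]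
  -- (2) Green with `u = R²`, `v = f`, the product rule and `Δf = 2 − R`:
  --     `2∫R² − ∫R³ = ∫ R² Δf = −∫ g⁻¹(d(R²), df) = −2∫ R g⁻¹(dR, df)`
  have e2 : 2 * ∫ x, g.scalarCurvature x ^ 2 ∂g.riemVolume -
      ∫ x, g.scalarCurvature x ^ 3 ∂g.riemVolume =
      -(2 * ∫ x, g.scalarCurvature x * g.innerDual x
          (mvfderiv (𝓡 4) g.scalarCurvature x : TangentSpace (𝓡 4) x →ₗ[ℝ] ℝ)
          (mvfderiv (𝓡 4) f x : TangentSpace (𝓡 4) x →ₗ[ℝ] ℝ) ∂g.riemVolume) := by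
    have h0 := integral_mul_dalembertian_riemVolume g hg hRR1 hf2
    have hpt : ∀ x, (g.scalarCurvature * g.scalarCurvature) x * g.dalembertian f x =
        2 * g.scalarCurvature x ^ 2 - g.scalarCurvature x ^ 3 := fun x ↦ by
      rw [Pi.mul_apply, hΔf x]
      ring
    rw [integral_congr_ae (ae_of_all _ hpt), integral_congr_ae (ae_of_all _ hprod),
      integral_sub i2R2 iR3, integral_const_mul, integral_const_mul] at h0
    exact h0
  -- (3) the right-hand side: `∫ R(|Ric|² − R²/4) = ∫R|Ric|² − ¼∫R³`
  have e3 : ∫ x, g.scalarCurvature x * (g.normSq x (g.ricci x) - g.scalarCurvature x ^ 2 / 4)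
      ∂g.riemVolume =
      ∫ x, g.scalarCurvature x * g.normSq x (g.ricci x) ∂g.riemVolume -
        1 / 4 * ∫ x, g.scalarCurvature x ^ 3 ∂g.riemVolume := by
    have hpt : ∀ x, g.scalarCurvature x * (g.normSq x (g.ricci x) - g.scalarCurvature x ^ 2 / 4) =
        g.scalarCurvature x * g.normSq x (g.ricci x) - 1 / 4 * g.scalarCurvature x ^ 3 :=
      fun x ↦ by ring
    rw [integral_congr_ae (ae_of_all _ hpt), integral_sub iRQ i4R3, integral_const_mul]
  rw [e3]
  linarith [e1, e2]

/-- **HELPER `helper_gradScalarCurvature_energy` of line `cgy-variance-pivot` — the unweighted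
scalar-gradient energy identity of a closed four-dimensional gradient shrinker.** For `g`
Riemannian (Levi-Civita) on a closed 4-manifold and `f` smooth with `Ric + Hess f = g/2`:
`∫ |∇R|² dV = 2 ∫ R (|Ric|² − R²/4) dV` (`= 2∫ R |E̊|² dV`, `E̊` the traceless Ricci tensor).
Identity (B) `ΔR = g⁻¹(dR, df) + R − 2|Ric|²` from the landed
`Theorems.stub_shrinkerScalarIdentities`, then `gradScalarCurvatureEnergy_of_identityB`
(`∫|∇R|² = −∫RΔR`, `∫ R g⁻¹(dR, df) = −½∫R²Δf = −∫R² + ½∫R³`). Check: round `S⁴(√6)`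
(`R ≡ 2`, `|Ric|² ≡ 1`): `0 = 0`. [cite: CaoZhu2010, (3.6)–(3.7)]
[cite: ChengRibeiroZhou2022, Lemma 1] [cite: EminentiNaveMantegazza2006, Prop. 2.2] -/
theorem helper_gradScalarCurvature_energy : ∀ (M : Type) [TopologicalSpace M] [T2Space M]
    [SecondCountableTopology M] [ChartedSpace (EuclideanSpace ℝ (Fin 4)) M] [IsManifold (𝓡 4) ∞ M]
    [CompactSpace M] [T3Space M] [MeasurableSpace M] [BorelSpace M]
    (g : Literature.Geometry.Lorentzian.PseudoRiemannianMetric (𝓡 4) ∞ (EuclideanSpace ℝ (Fin 4))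
      (TangentSpace (𝓡 4) : M → Type _)) [g.HasLeviCivita] (f : M → ℝ) (hg : g.IsRiemannian),
    ContMDiff (𝓡 4) 𝓘(ℝ, ℝ) ∞ f →
    (∀ (x : M) (X Y : TangentSpace (𝓡 4) x),
      g.ricci x X Y + g.hessian f x X Y = (1 / 2 : ℝ) * g.val x X Y) →
    ∫ x, g.gradSq (fun y => g.scalarCurvature y) x
        ∂(Literature.Geometry.Lorentzian.riemannianMeasure (g.toContMDiffRiemannianMetric hg)) =
      2 * ∫ x, g.scalarCurvature x * (g.normSq x (g.ricci x) - (g.scalarCurvature x) ^ 2 / 4)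
        ∂(Literature.Geometry.Lorentzian.riemannianMeasure (g.toContMDiffRiemannianMetric hg)) := by
  intro M _ _ _ _ _ _ _ _ _ g _ f hg hf hsol
  obtain ⟨_, hB⟩ := stub_shrinkerScalarIdentities M g f hg hf hsol
  exact gradScalarCurvatureEnergy_of_identityB M g f hg hf hsol hB

end Summit.SmoothPoincare4.SmoothPoincare4.Theorems

end
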